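import Summits.ResolutionOfSingularities.ResolutionOfSingularities.Theorems.FrobeniusClosingPatchingRelPerfectCuspLineStepGlue
import HarnessLib

/-!
# Crux `PatchingRelPerfect` (stmt-ResolutionOfSingularities-16161), chain w52 — kernel (iii)
# certificate of the cusp member, part 1b: chart images of the line-step residual

[OURS · L1 W5.2 · kernel (iii) certificate, CHAIN v1.7 §1 (C) «cusp (x₃²+x₀³)+𝔪⁴»] The hand route
of this seat's note `NONGRADED-CUSP-MEMBER.md` (evidence #52 on the crux item) for the simplest
NON-GRADED member `I = (x₃² + x₀³) + 𝔪⁴` of the `𝔪`-primary stratum of the open core reaches, on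
the `y`-charts of `Bl_𝔪`, the residual `K₃ = (c² + t a³) + (t²)` (`t` the exceptional
coordinate, `a = x₀/y`, `c = x₃/y`), of order `2` exactly along the LINE `V(t, a, c)`; blowing up
that line drops the exceptional exponent of the `t`-coefficient by one (`a`-chart:
`K_k ↦ a² · K_{k-1}`, the other two charts are Cartier), and after `k` line steps the residual
`K₀ = (t + c²) + (t²)` is the TANGENT EUCLID datum of `…TangentEuclidExplicit.lean` (p508825).
The LINE-STEP INDUCTION is proved at ring level, with the S-avatars of the note carried along as
residual factors (so that one global companion serves every chart):

  `F_k(t, c, a) = ∏_{1 ≤ j ≤ k} (t, aʲ, c) · [ ((c² + t aᵏ) + (t²)) · ( (c², t aᵏ, t²) ·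
                  ((c² + t aᵏ) + (t², t c)) ) · (t, c) ]`

This file (part 1b of 3): the `k = 0` identification of `F₀` with the tangent-Euclid ideal of
`CoreRungTower.tangent_euclid_two_two` (`F_zero`), the peeling `F_{k+1} = G_k · (t, c, a)`
(`F_succ`), and the images of the tail `G_k` on the three Rees charts of `Bl_{(t,c,a)} Spec R`
(`map_G_two`: `a^N · F_k(t/a, c/a, a)`; `map_G_zero`, `map_G_one`: principal monomials).  Any
commutative ring.  FORMAT evidence for the core (CHAIN §1 (C)); nothing here is a statement of the
manuscript under review.

## References

* Q. Liu, *Algebraic Geometry and Arithmetic Curves*, OUP 2002, Thm. 8.1.19 (a). [Liu2002]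
* The Stacks Project, Tags 080A, 080B, 0804, 0BIQ. [StacksProject]
* U. Görtz, T. Wedhorn, *Algebraic Geometry I* (2nd ed., 2020), Prop. 13.96 (2). [GortzWedhorn2020]
* H. Matsumura, *Commutative Ring Theory*, CUP 1986, Thm. 16.2 (i). [Matsumura1987]
-/

-- `Summit.<Summit>.<Sub>.Theorems` with `Sub = Summit` (single-conjunct summit, D-0017)
set_option linter.dupNamespace false

noncomputable section

open CategoryTheory CategoryTheory.Limits AlgebraicGeometry Literature.AlgebraicGeometry.Resolution
open scoped Pointwise nonZeroDivisors

namespace Summit.ResolutionOfSingularities.ResolutionOfSingularities.Theorems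

universe u

namespace CuspMember

/-! ## Notation: the residual factors of the line steps -/

/-- Line avatar `(t, aʲ⁺¹, c)`. -/
local notation3 "Lf[" t "," c "," a "," j "]" =>
  (Ideal.span {t} ⊔ Ideal.span {a ^ (j + 1)} ⊔ Ideal.span {c})
/-- The residual `K_k = (c² + t aᵏ) + (t²)` of the member itself. -/
local notation3 "Kf[" t "," c "," a "," k "]" => (Ideal.span {c ^ 2 + t * a ^ k} ⊔ Ideal.span {t ^ 2})
/-- The residual of the graded-hull avatar `J`: `(c², t aᵏ, t²)`. -/
local notation3 "Jf[" t "," c "," a "," k "]" =>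
  (Ideal.span {c ^ 2} ⊔ Ideal.span {t * a ^ k} ⊔ Ideal.span {t ^ 2})
/-- The residual of the avatar `I + x₃𝔪²`: `(c² + t aᵏ) + (t², t c)`. -/
local notation3 "Af[" t "," c "," a "," k "]" =>
  ((Ideal.span {c ^ 2 + t * a ^ k} ⊔ Ideal.span {t ^ 2}) ⊔ Ideal.span {t * c})
/-- The tangency locus `(t, c)`. -/
local notation3 "Sf[" t "," c "]" => Ideal.span (Set.range ![t, c])
/-- The tangent-Euclid block `K · (J · A) · (t, c)`. -/
local notation3 "Tf[" t "," c "," a "," k "]" =>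
  (Kf[t,c,a,k] * (Jf[t,c,a,k] * Af[t,c,a,k]) * Sf[t,c])
/-- The full residual `F_k = ∏_{j<k} (t, aʲ⁺¹, c) · T_k`. -/
local notation3 "Ff[" t "," c "," a "," k "]" =>
  ((∏ j ∈ Finset.range k, Lf[t,c,a,j]) * Tf[t,c,a,k])
/-- The tail `G_k` of `F_{k+1}` after peeling off the centre `(t, a, c)`. -/
local notation3 "Gf[" t "," c "," a "," k "]" =>
  ((∏ j ∈ Finset.range k, Lf[t,c,a,j + 1]) * Tf[t,c,a,k + 1])


section Algebra

variable {A : Type u} [CommRing A]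

/-! ### `k = 0`: the tangent-Euclid avatars -/

/-- `K₀ = (c² + t·a⁰) + (t²) = (t + c²) + (t²)`. [folklore] -/
theorem base_K (t c a : A) :
    Ideal.span {c ^ 2 + t * a ^ 0} ⊔ Ideal.span {t ^ 2} = Ideal.span {t + c ^ 2} ⊔ Ideal.span {t ^ 2} := by
  rw [pow_zero, mul_one, add_comm]

/-- `J₀ = (c², t·a⁰, t²) = (t + c²) + (c²)`. [folklore] -/
theorem base_J (t c a : A) :
    Ideal.span {c ^ 2} ⊔ Ideal.span {t * a ^ 0} ⊔ Ideal.span {t ^ 2} =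
      Ideal.span {t + c ^ 2} ⊔ Ideal.span {c ^ 2} := by
  rw [pow_zero, mul_one]
  have e1 : Ideal.span {c ^ 2} ⊔ Ideal.span {t} ⊔ Ideal.span {t ^ 2} = Ideal.span {c ^ 2} ⊔ Ideal.span {t} :=
    sup_eq_left.mpr (le_sup_of_le_right (Ideal.span_singleton_le_span_singleton.mpr ⟨t, by ring⟩))
  have e2 : Ideal.span {c ^ 2} ⊔ Ideal.span {t + c ^ 2} = Ideal.span {c ^ 2} ⊔ Ideal.span {t} :=
    CoreRungTower.sup_span_singleton_eq_of_sub_mem (by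
      rw [add_sub_cancel_left]; exact Ideal.mem_span_singleton_self _)
  rw [e1, ← e2, sup_comm]

/-- `A₀ = (t + c²) + (t², tc) = (t + c²) + (c³)`: `c³ = c (t + c²) - tc`, `tc = c (t + c²) - c³`,
`t² = (t - c²)(t + c²) + c · c³`. [folklore] -/
theorem base_A (t c : A) :
    (Ideal.span {t + c ^ 2} ⊔ Ideal.span {t ^ 2}) ⊔ Ideal.span {t * c} =
      Ideal.span {t + c ^ 2} ⊔ Ideal.span {c ^ 3} := by
  apply le_antisymm
  · refine sup_le (sup_le le_sup_left ?_) ?_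
    · rw [Ideal.span_singleton_le_iff_mem, Ideal.mem_span_singleton_sup]
      exact ⟨t - c ^ 2, c * c ^ 3, Ideal.mul_mem_left _ _ (Ideal.mem_span_singleton_self _), by ring⟩
    · rw [Ideal.span_singleton_le_iff_mem, Ideal.mem_span_singleton_sup]
      exact ⟨c, -c ^ 3, Submodule.neg_mem _ (Ideal.mem_span_singleton_self _), by ring⟩
  · refine sup_le (le_sup_of_le_left le_sup_left) ?_
    rw [Ideal.span_singleton_le_iff_mem, sup_assoc, Ideal.mem_span_singleton_sup]
    exact ⟨c, -(t * c), Submodule.neg_mem _ (Ideal.mem_sup_right (Ideal.mem_span_singleton_self _)),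
      by ring⟩

/-- **`F₀` is the tangent-Euclid ideal** of `CoreRungTower.tangent_euclid_two_two`. [folklore] -/
theorem F_zero (t c a : A) :
    Ff[t,c,a,0] = ((Ideal.span {t + c ^ 2} ⊔ Ideal.span {t ^ 2}) *
      ((Ideal.span {t + c ^ 2} ⊔ Ideal.span {c ^ 2}) * (Ideal.span {t + c ^ 2} ⊔ Ideal.span {c ^ 3}))) *
        Ideal.span (Set.range ![t, c]) := by
  rw [Finset.prod_range_zero, one_mul, base_K, base_J, base_A]

/-- **Peeling the centre**: `F_{k+1} = G_k · (t, c, a)`. [folklore] -/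
theorem F_succ (t c a : A) (k : ℕ) :
    Ff[t,c,a,k + 1] = Gf[t,c,a,k] * Ideal.span (Set.range ![t, c, a]) := by
  rw [Finset.prod_range_succ' (fun j => Lf[t,c,a,j]) k, zero_add, pow_one, span_range_vec3,
    sup_right_comm (Ideal.span {t}) (Ideal.span {c}) (Ideal.span {a}), mul_right_comm]

/-- Collecting the Cartier twist on the `a`-chart. [folklore] -/
theorem collect_twist (g : A) (k : ℕ) (L K J A' S : Ideal A) :
    (Ideal.span {g} ^ k * L) * ((Ideal.span {g ^ 2} * K) * ((Ideal.span {g ^ 2} * J) *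
      (Ideal.span {g ^ 2} * A')) * (Ideal.span {g} * S)) =
      Ideal.span {g ^ k * (g ^ 2 * (g ^ 2 * g ^ 2) * g)} * (L * (K * (J * A') * S)) := by
  rw [← Ideal.span_singleton_mul_span_singleton, ← Ideal.span_singleton_mul_span_singleton,
    ← Ideal.span_singleton_mul_span_singleton, ← Ideal.span_singleton_mul_span_singleton,
    ← Ideal.span_singleton_pow, ← Ideal.span_singleton_pow]
  ring

end Algebra

/-! ## The chart images of `G_k` on the three Rees charts of `Bl_{(t, c, a)} Spec R` -/

section Charts

variable {R : Type u} [CommRing R] (t c a : R)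

local notation3 "xx" => (![t, c, a] : Fin 3 → R)

set_option maxHeartbeats 400000 in
-- instance-path defeq through `HomogeneousLocalization`'s standalone `Pow`/`Mul` (as in p508825)
/-- **`a`-chart image of the tail `G_k`**: `G_k · B_a = a^N · F_k(t′, c′, a)`, `t′ = t/a`,
`c′ = c/a` (the same residual one step down, for the chart family).
[cite: StacksProject, Tag 0804] -/
theorem map_G_two (k : ℕ) :
    (Gf[t,c,a,k]).map (chartBase xx 2) =
      Ideal.span {chartBase xx 2 a ^ k * (chartBase xx 2 a ^ 2 * (chartBase xx 2 a ^ 2 *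
        chartBase xx 2 a ^ 2) * chartBase xx 2 a)} *
        Ff[chartGen xx 2 0, chartGen xx 2 1, chartBase xx 2 a, k] := by
  have cb_t_two : chartBase xx 2 t = chartBase xx 2 a * chartGen xx 2 0 :=
    reesChartBase_apply_eq_mul_chartGen xx 2 0
  have cb_c_two : chartBase xx 2 c = chartBase xx 2 a * chartGen xx 2 1 :=
    reesChartBase_apply_eq_mul_chartGen xx 2 1
  have hL : ∀ j : ℕ, (Lf[t,c,a,j + 1]).map (chartBase xx 2) =
      Ideal.span {chartBase xx 2 a} * Lf[chartGen xx 2 0, chartGen xx 2 1, chartBase xx 2 a, j] := by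
    intro j
    rw [Ideal.map_sup, Ideal.map_sup, map_span_singleton, map_span_singleton, map_span_singleton,
      map_pow, cb_t_two, cb_c_two]
    exact aChart_L _ _ _ j
  have hK : (Kf[t,c,a,k + 1]).map (chartBase xx 2) =
      Ideal.span {chartBase xx 2 a ^ 2} * Kf[chartGen xx 2 0, chartGen xx 2 1, chartBase xx 2 a, k] := by
    rw [Ideal.map_sup, map_span_singleton, map_span_singleton, map_add, map_pow, map_mul, map_pow,
      map_pow, cb_t_two, cb_c_two]
    exact aChart_K _ _ _ k
  have hJ : (Jf[t,c,a,k + 1]).map (chartBase xx 2) =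
      Ideal.span {chartBase xx 2 a ^ 2} * Jf[chartGen xx 2 0, chartGen xx 2 1, chartBase xx 2 a, k] := by
    rw [Ideal.map_sup, Ideal.map_sup, map_span_singleton, map_span_singleton, map_span_singleton,
      map_pow, map_mul, map_pow, map_pow, cb_t_two, cb_c_two]
    exact aChart_J _ _ _ k
  have hA : (Af[t,c,a,k + 1]).map (chartBase xx 2) =
      Ideal.span {chartBase xx 2 a ^ 2} * Af[chartGen xx 2 0, chartGen xx 2 1, chartBase xx 2 a, k] := by
    rw [Ideal.map_sup, hK, map_span_singleton, map_mul, cb_t_two, cb_c_two]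
    exact aChart_A _ _ _ _
  have hS : (Sf[t,c]).map (chartBase xx 2) =
      Ideal.span {chartBase xx 2 a} * Sf[chartGen xx 2 0, chartGen xx 2 1] := by
    rw [span_range_vec2, span_range_vec2, Ideal.map_sup, map_span_singleton, map_span_singleton,
      cb_t_two, cb_c_two]
    exact aChart_S _ _ _
  rw [Ideal.map_mul, CoreRungTower.map_prod_range, Ideal.map_mul, Ideal.map_mul, Ideal.map_mul, hK, hJ,
    hA, hS]
  simp_rw [hL]
  rw [Finset.prod_mul_distrib, Finset.prod_const, Finset.card_range]
  exact collect_twist _ k _ _ _ _ _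

set_option maxHeartbeats 400000 in
-- instance-path defeq through `HomogeneousLocalization`'s standalone `Pow`/`Mul` (as in p508825)
/-- **`t`-chart image of the tail `G_k`**: a principal monomial in `t/1`.
[cite: StacksProject, Tag 0804] -/
theorem map_G_zero (k : ℕ) :
    (Gf[t,c,a,k]).map (chartBase xx 0) =
      Ideal.span {chartBase xx 0 t ^ k * (chartBase xx 0 t ^ 2 * (chartBase xx 0 t ^ 2 *
        chartBase xx 0 t ^ 2) * chartBase xx 0 t)} := by
  have cb_c_zero : chartBase xx 0 c = chartBase xx 0 t * chartGen xx 0 1 :=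
    reesChartBase_apply_eq_mul_chartGen xx 0 1
  have cb_a_zero : chartBase xx 0 a = chartBase xx 0 t * chartGen xx 0 2 :=
    reesChartBase_apply_eq_mul_chartGen xx 0 2
  have hL : ∀ j : ℕ, (Lf[t,c,a,j + 1]).map (chartBase xx 0) = Ideal.span {chartBase xx 0 t} := by
    intro j
    rw [Ideal.map_sup, Ideal.map_sup, map_span_singleton, map_span_singleton, map_span_singleton,
      map_pow, cb_c_zero, cb_a_zero]
    exact tChart_L _ _ _ j
  have hK : (Kf[t,c,a,k + 1]).map (chartBase xx 0) = Ideal.span {chartBase xx 0 t ^ 2} := by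
    rw [Ideal.map_sup, map_span_singleton, map_span_singleton, map_add, map_pow, map_mul, map_pow,
      map_pow, cb_c_zero, cb_a_zero]
    exact tChart_K _ _ _ k
  have hJ : (Jf[t,c,a,k + 1]).map (chartBase xx 0) = Ideal.span {chartBase xx 0 t ^ 2} := by
    rw [Ideal.map_sup, Ideal.map_sup, map_span_singleton, map_span_singleton, map_span_singleton,
      map_pow, map_mul, map_pow, map_pow, cb_c_zero, cb_a_zero]
    exact tChart_J _ _ _ k
  have hA : (Af[t,c,a,k + 1]).map (chartBase xx 0) = Ideal.span {chartBase xx 0 t ^ 2} := by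
    rw [Ideal.map_sup, hK, map_span_singleton, map_mul, cb_c_zero]
    exact tChart_A _ _
  have hS : (Sf[t,c]).map (chartBase xx 0) = Ideal.span {chartBase xx 0 t} := by
    rw [span_range_vec2, Ideal.map_sup, map_span_singleton, map_span_singleton, cb_c_zero]
    exact tChart_S _ _
  rw [Ideal.map_mul, CoreRungTower.map_prod_range, Ideal.map_mul, Ideal.map_mul, Ideal.map_mul, hK, hJ,
    hA, hS]
  simp_rw [hL]
  rw [Finset.prod_const, Finset.card_range, Ideal.span_singleton_pow,
    Ideal.span_singleton_mul_span_singleton, Ideal.span_singleton_mul_span_singleton,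
    Ideal.span_singleton_mul_span_singleton, Ideal.span_singleton_mul_span_singleton]

set_option maxHeartbeats 400000 in
-- instance-path defeq through `HomogeneousLocalization`'s standalone `Pow`/`Mul` (as in p508825)
/-- **`c`-chart image of the tail `G_k`**: a principal monomial in `c/1`.
[cite: StacksProject, Tag 0804] -/
theorem map_G_one (k : ℕ) :
    (Gf[t,c,a,k]).map (chartBase xx 1) =
      Ideal.span {chartBase xx 1 c ^ k * (chartBase xx 1 c ^ 2 * (chartBase xx 1 c ^ 2 *
        chartBase xx 1 c ^ 2) * chartBase xx 1 c)} := by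
  have cb_t_one : chartBase xx 1 t = chartBase xx 1 c * chartGen xx 1 0 :=
    reesChartBase_apply_eq_mul_chartGen xx 1 0
  have cb_a_one : chartBase xx 1 a = chartBase xx 1 c * chartGen xx 1 2 :=
    reesChartBase_apply_eq_mul_chartGen xx 1 2
  have hL : ∀ j : ℕ, (Lf[t,c,a,j + 1]).map (chartBase xx 1) = Ideal.span {chartBase xx 1 c} := by
    intro j
    rw [Ideal.map_sup, Ideal.map_sup, map_span_singleton, map_span_singleton, map_span_singleton,
      map_pow, cb_t_one, cb_a_one]
    exact cChart_L _ _ _ j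
  have hK : (Kf[t,c,a,k + 1]).map (chartBase xx 1) = Ideal.span {chartBase xx 1 c ^ 2} := by
    rw [Ideal.map_sup, map_span_singleton, map_span_singleton, map_add, map_pow, map_mul, map_pow,
      map_pow, cb_t_one, cb_a_one]
    exact cChart_K _ _ _ k
  have hJ : (Jf[t,c,a,k + 1]).map (chartBase xx 1) = Ideal.span {chartBase xx 1 c ^ 2} := by
    rw [Ideal.map_sup, Ideal.map_sup, map_span_singleton, map_span_singleton, map_span_singleton,
      map_pow, map_mul, map_pow, map_pow, cb_t_one, cb_a_one]
    exact cChart_J _ _ _ k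
  have hA : (Af[t,c,a,k + 1]).map (chartBase xx 1) = Ideal.span {chartBase xx 1 c ^ 2} := by
    rw [Ideal.map_sup, hK, map_span_singleton, map_mul, cb_t_one]
    exact cChart_A _ _
  have hS : (Sf[t,c]).map (chartBase xx 1) = Ideal.span {chartBase xx 1 c} := by
    rw [span_range_vec2, Ideal.map_sup, map_span_singleton, map_span_singleton, cb_t_one]
    exact cChart_S _ _
  rw [Ideal.map_mul, CoreRungTower.map_prod_range, Ideal.map_mul, Ideal.map_mul, Ideal.map_mul, hK, hJ,
    hA, hS]
  simp_rw [hL]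
  rw [Finset.prod_const, Finset.card_range, Ideal.span_singleton_pow,
    Ideal.span_singleton_mul_span_singleton, Ideal.span_singleton_mul_span_singleton,
    Ideal.span_singleton_mul_span_singleton, Ideal.span_singleton_mul_span_singleton]

end Charts

end CuspMember

end Summit.ResolutionOfSingularities.ResolutionOfSingularities.Theorems

end
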